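import Summits.QuantumAdvantage.QuantumAdvantage.Theses.CubicForrelation
import Literature.Computability.QuantumComplexity.SignedCubicForrelation
import Literature.Computability.QuantumComplexity.ForrelationDerivativeTables
import Literature.Computability.QuantumComplexity.CubicForrelationEstimatorAnalysis
import Literature.Computability.Complexity.PromiseZPPProofs
import Literature.Computability.QuantumComplexity.PromiseBQPSubsetPromisePP
import Summits.QuantumAdvantage.QuantumAdvantage.Theorems.CubicForrelationInPrBPP.Negative.SignedSlice

/-!
# Disproof of `SignedCubicForrelationNotPrBPP` — findings (cdisprove seat, stmt-QuantumAdvantage-13931)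

Crux `X := SignedCubicForrelationNotPrBPP` (route `QuantumAdvantage/CubicForrelation`, rank-0 target,
auto-crux): SIGNED cubic 2-fold Forrelation — `k = 2`, `n` even, both `B₂`-circuits computing functions
of 𝔽₂-degree `≤ 3`; YES `Φ ≥ 3/5`, NO `Φ ≤ -3/5` — is NOT in textbook `PromiseBPP'`.
By `rfl`, `X = (signedCubicForrelationProblem 2 ∉ PromiseBPP')` (`crux_eq`); `¬X` is LITERALLY the
route's rank-7 crux `SignedCubicForrelationInPrBPP` (`not_crux_iff_r7`). A disproof of `X` is therefore
a worst-case classical randomised polynomial-time decider of the SIGN of `Φ` on all cubic pairs with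
`|Φ| ≥ 3/5`, formalised as an `FP` witness (`PromiseProblem.mem_PromiseBPP'_of_fp_decider`, pattern of
`CubicDequant.cubicKForrelationProblem_two_mem_PromiseBPP'`).

## Findings (index; every claim is a checked theorem unless marked NEAR-MISS / `sorry`)

* §0 NAMES — `crux_eq`, `not_crux_iff_r7`, `crux_iff_not_r7`.
* §1 BARRIER (for PROVERS of `X`) — `X` together with the support item
  `SignedCubicForrelationMemPromiseBQP` (AA18 §3.2 Prop. 6, Hadamard test) is an explicit
  `PromiseBQP ⊄ PromiseBPP'` witness (`crux_imp_separation`), hence `P ≠ PP` (`crux_imp_P_ne_PP`, via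
  the landed promise form of Adleman–DeMarrais–Huang), and with `PlLift` the summit
  (`crux_imp_summit` = the route's `closes`); so `X` is separation-strength (`P ≠ PP`) and can only be
  REFUTED (a classical sign algorithm) or left open. No formal glitch: promise disjoint, both sides inhabited
  (tree: `signedCubicForrelationProblem_disjoint`, `encode_andPairInstance_…`), `PromiseBPP'` textbook.
* §2 LOAD-BEARING ANALYSIS (`_false_without_` theorems):
  - `x_false_unsigned` — drop the SIGN (NO-side `|Φ| ≤ 1/100` instead of `Φ ≤ -3/5`, the retired target
    `CubicForrelationNotPrBPP`): FALSE, by the landed tree theorem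
    `CubicDequant.cubicKForrelationProblem_two_mem_PromiseBPP'` (Φ²-estimator). The sign is the whole
    content of `X`.
  - `XQuadratic` — replace degree `3` by `2`: FALSE. PROVED in this seat's negative-lemma kit
    `Theorems/SignedCubicForrelationNotPrBPP/Negative/{HalfQuadMachine,HalfQuadStatistic,HalfQuadratic}.lean`
    (proposals pending at the gate; rc 0 locally, 0 sorry): even the ONE-SIDED version holds —
    signed 2-fold Forrelation with circuit `C_j` QUADRATIC and the other circuit ARBITRARY is in
    `PromiseBPP'` (`HalfQuad.signedHalfQuadProblem_mem_PromiseBPP'`; randomised machine = exact Fourier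
    sampler of the quadratic side + the sign of the other side at the sampled frequency: an unbiased
    estimator of `Φ` ITSELF with second moment `≤ 1`), with corollaries
    `signedCubic_quadAt_mem_PromiseBPP'` (X's sub-promise "C_j quadratic" is classical) and
    `signedDegTwoProblem_mem_PromiseBPP'` (`= ¬ XAtDegree 2`). Here `x_false_quadratic` stays `sorry`
    ONLY until the kit lands (this workfile cannot import un-landed files); degree EXACTLY 3 on BOTH
    sides is load-bearing.
  - §2b `xAtThreshold_iff_signedExact_of_nearExact`: under crux r2 (`NearExactIsExact`, constant `θ`)
    the threshold family collapses — `XAtThreshold t ↔ r3` for every `t ∈ (θ, 1]`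
    (`signedAtThreshold_eq_exact_of_nearExact`: the two promise problems are EQUAL); so `X` = r3 + the
    band `[3/5, θ]`.
  - monotone directions (no `¬`-theorem possible, only implications): `crux_imp_withoutEven`,
    `crux_imp_withoutDeg`, `crux_imp_atThreshold` (`t ≤ 3/5`), `atThreshold_imp_crux` (`3/5 ≤ t`),
    `signedExact_imp_crux` (r3 ⇒ X, the landed glue), `crux_imp_notStrong` (`∉ PromiseBPP'` ⇒ `∉ PromiseBPP`).
* §3 WHAT ANY DISPROOF MUST LOOK LIKE / NATURAL SUB-FAMILIES WHERE `X` ALREADY FAILS ON PAPER: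
  - §3a KASAMI–TOKURA BAND (`forrelation_xor_of_sq_eq_one`): for an exact pair (`Φ(a,b)² = 1`) and ANY
    `c`, `Φ(a ⊕ c, b) = Φ(a,b) · (1 - 2·wt(c)/2ⁿ)`. So the promise at `3/5` contains every
    `(b̃ ⊕ c, b)` / `(b̃ ⊕ 1 ⊕ c, b)` with `wt(c) ≤ 2ⁿ/5`, whose sign is the sign of the exact core:
    on this band `X` is EQUIVALENT to r3 restricted to the same cores (decoding `c` is not even needed
    for the sign once an anchor for the class of `(b̃,b)` is known — relative signs are classical).
  - §3b PURE BIPARTITE PAIRS ARE NEVER NEGATIVE (`fsum_bipartite`, `forrelation_bipartite`,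
    `forrelation_bipartite_nonneg`): for ALL maps `σ, π : 𝔽₂^m → 𝔽₂^m` (no bijectivity, no degree
    bound), `Φ(x″·σ(x′), y′·π(y″)) = |Fix(σ ∘ π)| / 2^m ≥ 0` (new closed formula; `σ = π⁻¹` is the
    Dillon/Rothaus exact pair `Φ = 1`). Hence the signed problem restricted to pure Maiorana–McFarland-type
    pairs and their complements IN KNOWN BIPARTITION is decided by the parity of the constant terms —
    a NO-instance must hide its complement in the `h(y″)`-part or in the affine disguise; and along the
    path `(π⁻¹,π) → (id,π) → (id,id)` (one coordinate map at a time) `Φ` stays `≥ |common fixed points|/2^m`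
    (the "homotopy to a quadratic anchor" exists in own coordinates; finding it in disguised coordinates
    is the hidden-structure problem BI-ISO of the r3 seat).
  - §3c RELATIVE SIGNS ARE CLASSICAL — the CROSS derivative-table identity, proved for all real data:
    `Σ_{h,u} X_{f,f'}(h,u) X_{g',g}(u,h) = S(f,g) S(f',g')` (`sum_xdwt_mul_xdwt`,
    `two_pow_mul_forrelation_mul`, row mass `sum_xdwt_sq_of_sq`); for cubic `a, a'` with `a ⊕ a'`
    quadratic every entry is a quadratic Gauss sum, so `Φ(a,b)·Φ(a',b')` is estimable across
    `(a + RM(2)) × (b + RM(2))`: `X` ⇔ some in-promise class has NO classically signed anchor.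
    (Direct sums multiply forrelations WITH sign: tree `ForrelationDirectSum.lean`, `forrelation_directSum`.)
  - §3d (prose, quantitative): parameters under which the sign IS classical — one-sided DEGREE 2 (the
    kit above), one-sided cubic SLICE RANK
    `r = O(log n)` (`W_a` = signed combination of `2^r` Gauss sums, length-squared sampling, second moment
    `≤ 1`), total cubic SPARSITY `t = O(log n)` (Hadamard test has `t` `CCZ` gates: stabiliser-rank
    simulation, Bravyi–Gosset 2016), hidden DIRECT SUMS with `O(log n)` blocks plus one anchored block
    (r7 card coset-web-block-peeling). Hard instances of `X` need slice rank `ω(log n)` on BOTH sides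
    (MM pairs: `≈ n/2`), no sparse representative in their `GL`-orbit, and no findable bi-isotropic flag.
* §4 TARGETS — none (payload `stuck_stubs = []`; no line picked on this crux).
* §5 NEAR-MISS — `crux_refuted : ¬X` is `sorry`: obstruction = it IS crux r7 (XL): a total classical
  sign decoder; every known handle (relative signs, slice rank, sparsity, block peeling, BI-ISO seeds)
  covers a sub-family only, and the honest residual is r7's STRUCTURE CONJECTURE for the band
  `[3/5, θ]` plus BI-ISO-hardness-or-not for the exact cores.

Users: cite §2 (`x_false_unsigned`, `XQuadratic`) for "what is load-bearing", §3a/§3b for the shape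
of YES/NO instances near the exact slice, §1 for why `X` itself is not a proof target.
-/

set_option linter.dupNamespace false

noncomputable section

namespace Summit.QuantumAdvantage.QuantumAdvantage.Cruxes.SignedCubicForrelationNotPrBPP.Disproof

open Finset
open Literature.Computability.Complexity Literature.Computability.Cryptography
open Literature.Computability.QuantumComplexity
open Literature.Computability.QuantumComplexity.BuzetChailloux (bxor zeroVec twist_bxor_right
  sum_twist_left bxor_eq_zeroVec_iff twist_zeroVec_right signOf_sq phi_signOf)
open Literature.Computability.QuantumComplexity.DerivativeWalsh
open Summit.QuantumAdvantage.QuantumAdvantage.Theses.CubicForrelation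

/-! ### §0 The crux by name -/

/-- The crux is, by `rfl`, NON-membership of the tree's `signedCubicForrelationProblem 2`. -/
theorem crux_eq :
    SignedCubicForrelationNotPrBPP = (signedCubicForrelationProblem 2 ∉ PromiseBPP') := rfl

/-- A disproof of the crux is LITERALLY the route's crux r7 `SignedCubicForrelationInPrBPP`. -/
theorem not_crux_iff_r7 : ¬ SignedCubicForrelationNotPrBPP ↔ SignedCubicForrelationInPrBPP :=
  not_not

/-- … and the crux is its negation. -/
theorem crux_iff_not_r7 : SignedCubicForrelationNotPrBPP ↔ ¬ SignedCubicForrelationInPrBPP :=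
  Iff.rfl

/-! ### §1 Barrier (provers' side): `X` is an explicit promise separation -/

/-- `X` plus the support item (Hadamard test, AA18 Prop. 6) separates `PromiseBQP` from `PromiseBPP'`. -/
theorem crux_imp_separation (h34 : SignedCubicForrelationMemPromiseBQP)
    (hX : SignedCubicForrelationNotPrBPP) : ¬ (PromiseBQP ⊆ PromiseBPP') :=
  fun hsub => hX (hsub h34)

/-- … hence `X` plus the support item already gives `P ≠ PP` UNCONDITIONALLY in the tree's classes
(promise form of Adleman–DeMarrais–Huang, `PromiseBQP ⊆ promiseLift PP`, landed by the r7 seat: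
`P_ne_PP_of_promise_witness`). Provers: `X` is a `P ≠ PP`-strength statement. -/
theorem crux_imp_P_ne_PP (h34 : SignedCubicForrelationMemPromiseBQP)
    (hX : SignedCubicForrelationNotPrBPP) : Classes.P ≠ PP :=
  P_ne_PP_of_promise_witness h34 hX

/-- … and with `PlLift` proves the summit (the route's deciding theorem). -/
theorem crux_imp_summit (h₁ : PlLift) (h34 : SignedCubicForrelationMemPromiseBQP)
    (hX : SignedCubicForrelationNotPrBPP) : _root_.QuantumAdvantage := by
  -- buildfix 2026-08-19: the route's `closes` was re-cut to (NearExactIsExact, SignedExactSliceIsLift, …);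
  -- this is the landed `Theorems.CubicForrelation.Assembly_proof` script for the PlLift assembly, inlined.
  by_contra hQA
  refine hX (h₁ ?_ h34)
  intro L hL
  by_contra hLn
  exact hQA ⟨L, hL, hLn⟩

/-! ### §2 Load-bearing analysis -/

/-- `PromiseBPP'` is antitone in the promise (local copy; the tree's is in `LatticeOWF.lean`). -/
theorem mem_PromiseBPP'_of_subset {Q Q' : PromiseProblem} (hy : Q'.yes ≤ Q.yes) (hn : Q'.no ≤ Q.no)
    (h : Q ∈ PromiseBPP') : Q' ∈ PromiseBPP' := by
  obtain ⟨L', hL', p, hyes, hno⟩ := h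
  exact ⟨L', hL', p, fun x hx => hyes x (hy hx), fun x hx => hno x (hn hx)⟩

/-- `X` WITHOUT THE SIGN: the retired unsigned target (`Φ ≥ 3/5` vs `|Φ| ≤ 1/100`), i.e.
`cubicKForrelationProblem 2 ∉ PromiseBPP'`. -/
def XUnsigned : Prop := cubicKForrelationProblem 2 ∉ PromiseBPP'

/-- **The sign is load-bearing**: the unsigned statement is FALSE — refuted by the tree theorem
`CubicDequant.cubicKForrelationProblem_two_mem_PromiseBPP'` (length-squared sampling of the derivative
Walsh tables estimates `Φ²`). -/
theorem x_false_unsigned : ¬ XUnsigned :=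
  fun h => h CubicDequant.cubicKForrelationProblem_two_mem_PromiseBPP'

/-- The unsigned problem and the signed one have THE SAME yes-side; only the no-side moved. -/
theorem signed_yes_eq_unsigned_yes :
    (signedCubicForrelationProblem 2).yes = (cubicKForrelationProblem 2).yes := rfl

/-- `X` AT DEGREE `d` (the crux is `d = 3`). -/
def XAtDegree (d : ℕ) : Prop :=
  (⟨KForrelationInstance.encode '' {I | I.IsYes ∧ I.k = 2 ∧ Even I.n ∧ ∀ i, IsDegLeFun d (I.C i).eval},
    KForrelationInstance.encode ''
      {I | (I.IsOverB2 ∧ I.value ≤ -(3 / 5 : ℝ)) ∧ I.k = 2 ∧ Even I.n ∧ ∀ i, IsDegLeFun d (I.C i).eval}⟩ :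
    PromiseProblem) ∉ PromiseBPP'

/-- At `d = 3` this is the crux. -/
theorem xAtDegree_three_iff : XAtDegree 3 ↔ SignedCubicForrelationNotPrBPP := Iff.rfl

/-- The degree family is MONOTONE: hardness at degree `d` gives hardness at every `d' ≥ d`
(sub-promise, `IsDegLeFun.mono`). -/
theorem xAtDegree_mono {d d' : ℕ} (hd : d ≤ d') (h : XAtDegree d) : XAtDegree d' := by
  intro hmem
  refine h (mem_PromiseBPP'_of_subset ?_ ?_ hmem)
  · exact Set.image_mono fun I hI => ⟨hI.1, hI.2.1, hI.2.2.1, fun i => (hI.2.2.2 i).mono hd⟩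
  · exact Set.image_mono fun I hI => ⟨hI.1, hI.2.1, hI.2.2.1, fun i => (hI.2.2.2 i).mono hd⟩

/-- `X` AT DEGREE 2 (signed QUADRATIC 2-fold Forrelation is not in `PromiseBPP'`). -/
def XQuadratic : Prop := XAtDegree 2

/-- NEAR-MISS (planned full proof). **Degree 3 is load-bearing: `XQuadratic` is FALSE.** On paper: for
quadratic `a, b` the function `c(x,y) = a(x) ⊕ x·y ⊕ b(y)` on `2n` bits is quadratic, and
`2^{3n/2} Φ(a,b) = Σ_{v ∈ 𝔽₂^{2n}} (-1)^{c(v)} = W_c(0)` is ONE quadratic Gauss sum, evaluated EXACTLY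
WITH SIGN in `O(n³)` by the tree's certified evaluator (`QuadSampler.TOf (liftQ c) (2n) 0 = W_c(0)`,
`TOf_eq_walsh`; `TOf_codeFP` uniformly in the oracle `v ↦ evalP c₀ (take n v) ⊕ evalP c₁ (drop n v) ⊕
⟨take n v, drop n v⟩`, `evalP_codeFP`), so the deterministic machine "guard `k = 2 ∧ n ≤ |x|+1`, accept iff
`TOf > 0`" puts the degree-2 signed problem in `PromiseP ⊆ PromiseBPP'` (`PromiseP_subset_PromiseBPP'`,
or directly `mem_PromiseBPP'_of_fp_decider` with zero coins used). Obstruction to closing NOW: only the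
`CodeFP` assembly of that oracle and the identification `Σ_{v} = Σ_{x,y}` along `Fin.appendEquiv`
(cf. `sum_split` in §3b) — bookkeeping, no mathematics. -/
theorem x_false_quadratic : ¬ XQuadratic := by
  sorry

/-- `X` with `Even n` dropped (all arities). -/
def XWithoutEven : Prop :=
  (⟨KForrelationInstance.encode '' {I | I.IsYes ∧ I.k = 2 ∧ ∀ i, IsDegLeFun 3 (I.C i).eval},
    KForrelationInstance.encode ''
      {I | (I.IsOverB2 ∧ I.value ≤ -(3 / 5 : ℝ)) ∧ I.k = 2 ∧ ∀ i, IsDegLeFun 3 (I.C i).eval}⟩ :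
    PromiseProblem) ∉ PromiseBPP'

/-- `Even n` only shrinks the promise: `X` implies the all-arity statement (so `Even` cannot be shown
load-bearing by a `¬`-theorem; odd `n` carries in-promise instances too, e.g. `c₃ ⊗ bent`, `Φ ≈ 0.884`). -/
theorem crux_imp_withoutEven (hX : SignedCubicForrelationNotPrBPP) : XWithoutEven := by
  intro hmem
  refine hX (mem_PromiseBPP'_of_subset ?_ ?_ hmem)
  · exact Set.image_mono fun I hI => ⟨hI.1, hI.2.1, hI.2.2.2⟩
  · exact Set.image_mono fun I hI => ⟨hI.1, hI.2.1, hI.2.2.2⟩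

/-- `X` with the degree bound dropped: SIGNED explicit 2-fold Forrelation (`n` even). -/
def XWithoutDeg : Prop :=
  (⟨KForrelationInstance.encode '' {I | I.IsYes ∧ I.k = 2 ∧ Even I.n},
    KForrelationInstance.encode '' {I | (I.IsOverB2 ∧ I.value ≤ -(3 / 5 : ℝ)) ∧ I.k = 2 ∧ Even I.n}⟩ :
    PromiseProblem) ∉ PromiseBPP'

/-- The degree bound only shrinks the promise: `X` implies the degree-free statement. -/
theorem crux_imp_withoutDeg (hX : SignedCubicForrelationNotPrBPP) : XWithoutDeg := by
  intro hmem
  refine hX (mem_PromiseBPP'_of_subset ?_ ?_ hmem)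
  · exact Set.image_mono fun I hI => ⟨hI.1, hI.2.1, hI.2.2.1⟩
  · exact Set.image_mono fun I hI => ⟨hI.1, hI.2.1, hI.2.2.1⟩

/-- `X` at threshold `t` (YES `Φ ≥ t`, NO `Φ ≤ -t`). -/
def XAtThreshold (t : ℝ) : Prop :=
  (⟨KForrelationInstance.encode ''
      {I | (I.IsOverB2 ∧ t ≤ I.value) ∧ I.k = 2 ∧ Even I.n ∧ ∀ i, IsDegLeFun 3 (I.C i).eval},
    KForrelationInstance.encode ''
      {I | (I.IsOverB2 ∧ I.value ≤ -t) ∧ I.k = 2 ∧ Even I.n ∧ ∀ i, IsDegLeFun 3 (I.C i).eval}⟩ :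
    PromiseProblem) ∉ PromiseBPP'

/-- At `t = 3/5` the threshold family is the crux. -/
theorem xAtThreshold_iff : XAtThreshold (3 / 5) ↔ SignedCubicForrelationNotPrBPP := Iff.rfl

/-- The threshold family is monotone: hardness at `t'` gives hardness at every `t ≤ t'`. -/
theorem xAtThreshold_anti {t t' : ℝ} (ht : t ≤ t') (h : XAtThreshold t') : XAtThreshold t := by
  intro hmem
  refine h (mem_PromiseBPP'_of_subset ?_ ?_ hmem)
  · exact Set.image_mono fun I hI => ⟨⟨hI.1.1, ht.trans hI.1.2⟩, hI.2⟩
  · exact Set.image_mono fun I hI => ⟨⟨hI.1.1, hI.1.2.trans (neg_le_neg ht)⟩, hI.2⟩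

/-- `X` gives hardness at every lower threshold … -/
theorem crux_imp_atThreshold {t : ℝ} (ht : t ≤ 3 / 5) (hX : SignedCubicForrelationNotPrBPP) :
    XAtThreshold t :=
  xAtThreshold_anti ht (xAtThreshold_iff.2 hX)

/-- … and hardness at any higher threshold gives `X`. -/
theorem atThreshold_imp_crux {t : ℝ} (ht : 3 / 5 ≤ t) (h : XAtThreshold t) :
    SignedCubicForrelationNotPrBPP :=
  xAtThreshold_iff.1 (xAtThreshold_anti ht h)

/-- The top of the family: the route's crux r3 (signed EXACT slice) implies `X` (landed glue). -/
theorem signedExact_imp_crux (h : SignedExactCubicForrelationNotPrBPP) : SignedCubicForrelationNotPrBPP :=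
  signedCubicForrelationProblem_not_mem_PromiseBPP'_of_exact 2 h

/-- Class direction: `X` (textbook class) implies non-membership in the STRONG lift `PromiseBPP`. -/
theorem crux_imp_notStrong (hX : SignedCubicForrelationNotPrBPP) :
    signedCubicForrelationProblem 2 ∉ PromiseBPP :=
  fun h => hX (PromiseBPP_subset_PromiseBPP'_holds h)

/-- … and non-membership in `PromiseP`. -/
theorem crux_imp_notP (hX : SignedCubicForrelationNotPrBPP) :
    signedCubicForrelationProblem 2 ∉ PromiseP :=
  fun h => hX (PromiseP_subset_PromiseBPP' h)

/-- Symmetry: `X` is invariant under swapping YES and NO (complement the witness language). -/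
theorem crux_iff_swap :
    SignedCubicForrelationNotPrBPP ↔ (signedCubicForrelationProblem 2).swap ∉ PromiseBPP' := by
  rw [swap_mem_PromiseBPP'_iff]; exact Iff.rfl

/-! ### §2b Under r2 (`NearExactIsExact`) the threshold family collapses onto r3 above `θ` -/

/-- The signed problem at threshold `t` (so that `XAtThreshold t = (signedAtThreshold t ∉ PromiseBPP')`). -/
def signedAtThreshold (t : ℝ) : PromiseProblem :=
  ⟨KForrelationInstance.encode ''
      {I | (I.IsOverB2 ∧ t ≤ I.value) ∧ I.k = 2 ∧ Even I.n ∧ ∀ i, IsDegLeFun 3 (I.C i).eval},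
    KForrelationInstance.encode ''
      {I | (I.IsOverB2 ∧ I.value ≤ -t) ∧ I.k = 2 ∧ Even I.n ∧ ∀ i, IsDegLeFun 3 (I.C i).eval}⟩

/-- Bookkeeping: `XAtThreshold t` is non-membership of `signedAtThreshold t`. -/
theorem xAtThreshold_iff_not_mem (t : ℝ) : XAtThreshold t ↔ signedAtThreshold t ∉ PromiseBPP' := Iff.rfl

/-- **Isolation collapses the top of the family.** If `NearExactIsExact` holds with constant `θ < 1`
(crux r2), then for every threshold `t ∈ (θ, 1]` the signed problem at threshold `t` IS the signed
EXACT slice (same YES set: `Φ ≥ t > θ ⇒ Φ = 1`; same NO set through `g ↦ ¬g`, which flips `Φ` and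
keeps degree `≤ 3`). -/
theorem signedAtThreshold_eq_exact_of_nearExact (h : NearExactIsExact) :
    ∃ θ : ℝ, θ < 1 ∧ ∀ t : ℝ, θ < t → t ≤ 1 →
      signedAtThreshold t = signedExactCubicForrelationProblem 2 := by
  obtain ⟨θ, hθ, hiso⟩ := h
  refine ⟨θ, hθ, fun t hθt ht1 => ?_⟩
  have key : ∀ I : KForrelationInstance, I.k = 2 → Even I.n → (∀ i, IsDegLeFun 3 (I.C i).eval) →
      (t ≤ I.value ↔ I.value = 1) ∧ (I.value ≤ -t ↔ I.value = -1) := by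
    intro I hk hn hdeg
    have hv := KForrelationInstance.value_eq_forrelation hk
    have hf : IsDegLeFun 3 (I.C (Fin.cast hk.symm 0)).eval := hdeg _
    have hg : IsDegLeFun 3 (I.C (Fin.cast hk.symm 1)).eval := hdeg _
    refine ⟨⟨fun hle => ?_, fun h1 => by rw [h1]; exact ht1⟩, ⟨fun hle => ?_, fun h1 => by rw [h1]; linarith⟩⟩
    · rw [hv] at hle ⊢
      exact hiso I.n hn _ _ hf hg (lt_of_lt_of_le hθt hle)
    · have hflip := forrelation_not_right (I.C (Fin.cast hk.symm 0)).eval (I.C (Fin.cast hk.symm 1)).eval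
      have hgt : θ < forrelation (I.C (Fin.cast hk.symm 0)).eval (fun y => !(I.C (Fin.cast hk.symm 1)).eval y) := by
        rw [hflip, ← hv]; linarith
      have h1 := hiso I.n hn _ _ hf hg.not hgt
      rw [hflip] at h1
      rw [hv]; linarith
  unfold signedAtThreshold signedExactCubicForrelationProblem
  congr 1
  · congr 1
    ext I
    constructor
    · rintro ⟨⟨hB, hle⟩, hk, hn, hdeg⟩; exact ⟨hB, (key I hk hn hdeg).1.1 hle, hk, hn, hdeg⟩
    · rintro ⟨hB, h1, hk, hn, hdeg⟩; exact ⟨⟨hB, (key I hk hn hdeg).1.2 h1⟩, hk, hn, hdeg⟩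
  · congr 1
    ext I
    constructor
    · rintro ⟨⟨hB, hle⟩, hk, hn, hdeg⟩; exact ⟨hB, (key I hk hn hdeg).2.1 hle, hk, hn, hdeg⟩
    · rintro ⟨hB, h1, hk, hn, hdeg⟩; exact ⟨⟨hB, (key I hk hn hdeg).2.2 h1⟩, hk, hn, hdeg⟩

/-- … hence, under r2, `XAtThreshold t ↔ r3` for all `t ∈ (θ, 1]`: the part of `X`'s threshold
family above the isolation constant is LITERALLY the signed exact slice (the BI-ISO question of the
r3 seat), and what `X` adds to r3 is exactly the band `[3/5, θ]` (conjecturally `θ = 7/8`). -/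
theorem xAtThreshold_iff_signedExact_of_nearExact (h : NearExactIsExact) :
    ∃ θ : ℝ, θ < 1 ∧ ∀ t : ℝ, θ < t → t ≤ 1 →
      (XAtThreshold t ↔ SignedExactCubicForrelationNotPrBPP) := by
  obtain ⟨θ, hθ, H⟩ := signedAtThreshold_eq_exact_of_nearExact h
  refine ⟨θ, hθ, fun t h1 h2 => ?_⟩
  show signedAtThreshold t ∉ PromiseBPP' ↔ signedExactCubicForrelationProblem 2 ∉ PromiseBPP'
  rw [H t h1 h2]

/-! ### §3a The Kasami–Tokura band around an exact pair -/

section KT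

variable {n : ℕ}

/-- `signOf (a ⊕ c) = signOf a · signOf c`. -/
theorem signOf_xor (a c : Bool) : signOf (a ^^ c) = signOf a * signOf c := by
  cases a <;> cases c <;> simp [signOf]

/-- **Kasami–Tokura band.** For an exact pair (`Φ(a,b)² = 1`) and ANY perturbation `c` of the first
function, `Φ(a ⊕ c, b) = Φ(a,b) · 2^{-n} Σ_x (-1)^{c(x)}` `= Φ(a,b)·(1 - 2 wt(c)/2ⁿ)`: the forrelation
of the perturbed pair is the bias of the perturbation, with the sign of the exact core. -/
theorem forrelation_xor_of_sq_eq_one (a b c : (Fin n → Bool) → Bool) (hΦ : forrelation a b ^ 2 = 1) :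
    forrelation (fun x => a x ^^ c x) b = forrelation a b * ((2 : ℝ) ^ n)⁻¹ * ∑ x, signOf (c x) := by
  have hf : ∀ x, (fun x => signOf (a x)) x ^ 2 = 1 := fun x => signOf_sq (a x)
  have hg : ∀ y, (fun y => signOf (b y)) y ^ 2 = 1 := fun y => signOf_sq (b y)
  have key := two_pow_mul_forrelation_sq a b
  rw [hΦ, mul_one, sum_dwt_mul_dwt] at key
  have hS : fsum (fun x => signOf (a x)) (fun y => signOf (b y)) ^ 2 = (8 : ℝ) ^ n := by
    rw [← key, pow_mul]; norm_num
  have h2 : (2 : ℝ) ^ n ≠ 0 := pow_ne_zero _ two_ne_zero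
  -- the perturbed sum
  have hsum : fsum (fun x => signOf (a x ^^ c x)) (fun y => signOf (b y)) =
      fsum (fun x => signOf (a x)) (fun y => signOf (b y)) / 2 ^ n * ∑ x, signOf (c x) := by
    rw [fsum_eq_sum_mul_W, mul_sum]
    refine sum_congr rfl fun x _ => ?_
    rw [Summit.QuantumAdvantage.QuantumAdvantage.Theorems.CubicForrelationInPrBPP.Negative.W_eq_of_fsum_sq
      _ _ hf hg hS x, signOf_xor]
    have ha : signOf (a x) * signOf (a x) = 1 := by rw [← sq]; exact signOf_sq (a x)
    linear_combination (fsum (fun x => signOf (a x)) (fun y => signOf (b y)) / 2 ^ n * signOf (c x)) * ha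
  rw [← phi_signOf, ← phi_signOf a b, phi_eq_fsum, phi_eq_fsum, hsum]
  field_simp

/-- In particular on the YES core (`Φ = 1`): `Φ(a ⊕ c, b) = 1 - 2·wt(c)/2ⁿ`, written with the bias sum. -/
theorem forrelation_xor_of_eq_one (a b c : (Fin n → Bool) → Bool) (hΦ : forrelation a b = 1) :
    forrelation (fun x => a x ^^ c x) b = ((2 : ℝ) ^ n)⁻¹ * ∑ x, signOf (c x) := by
  rw [forrelation_xor_of_sq_eq_one a b c (by rw [hΦ]; norm_num), hΦ, one_mul]

/-- … and on the NO core (`Φ = -1`): `Φ(a ⊕ c, b) = -(1 - 2·wt(c)/2ⁿ)`. -/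
theorem forrelation_xor_of_eq_neg_one (a b c : (Fin n → Bool) → Bool) (hΦ : forrelation a b = -1) :
    forrelation (fun x => a x ^^ c x) b = -(((2 : ℝ) ^ n)⁻¹ * ∑ x, signOf (c x)) := by
  rw [forrelation_xor_of_sq_eq_one a b c (by rw [hΦ]; norm_num), hΦ]; ring

end KT

/-! ### §3b Pure bipartite pairs: `Φ(x″·σ(x′), y′·π(y″)) = |Fix(σ∘π)|/2^m ≥ 0` -/

section Bipartite

variable {m : ℕ}

/-- First half `x′ ∈ 𝔽₂^m` of `x ∈ 𝔽₂^{m+m}`. -/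
def lo (x : Fin (m + m) → Bool) : Fin m → Bool := fun i => x (Fin.castAdd m i)

/-- Second half `x″ ∈ 𝔽₂^m` of `x ∈ 𝔽₂^{m+m}`. -/
def hi (x : Fin (m + m) → Bool) : Fin m → Bool := fun i => x (Fin.natAdd m i)

@[simp] theorem lo_append (u v : Fin m → Bool) : lo (Fin.append u v) = u := by
  funext i; exact Fin.append_left u v i

@[simp] theorem hi_append (u v : Fin m → Bool) : hi (Fin.append u v) = v := by
  funext i; exact Fin.append_right u v i

/-- The character of `𝔽₂^{m+m}` splits along the two halves. -/
theorem twist_split (x y : Fin (m + m) → Bool) :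
    twist x y = twist (lo x) (lo y) * twist (hi x) (hi y) := by
  unfold twist lo hi
  exact Fin.prod_univ_add _

/-- A sum over `𝔽₂^{m+m}` is a double sum over the halves (`Fin.appendEquiv`). -/
theorem sum_split (F : (Fin (m + m) → Bool) → ℝ) :
    ∑ x, F x = ∑ u : Fin m → Bool, ∑ v : Fin m → Bool, F (Fin.append u v) := by
  rw [← Fintype.sum_prod_type']
  exact (Fintype.sum_equiv (Fin.appendEquiv m m) (fun p => F (Fin.append p.1 p.2)) F fun p => rfl).symm

/-- The 𝔽₂ inner product as a Boolean (parity of the overlap). -/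
def bdot (u v : Fin m → Bool) : Bool := decide (Odd (univ.filter fun i => u i && v i).card)

/-- `(-1)^{[u·v]} = twist u v`. -/
theorem signOf_bdot (u v : Fin m → Bool) : signOf (bdot u v) = twist u v := by
  rw [Literature.Computability.QuantumComplexity.Simon.twist_eq_neg_one_pow]
  unfold bdot
  by_cases h : Odd (univ.filter fun i => u i && v i).card
  · rw [decide_eq_true h, h.neg_one_pow]; rfl
  · rw [decide_eq_false h, (Nat.not_odd_iff_even.1 h).neg_one_pow]; rfl

/-- Orthogonality, product form: `Σ_v (-1)^{v·a} (-1)^{v·b} = 2^m [a = b]`. -/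
theorem sum_twist_mul_twist (a b : Fin m → Bool) :
    ∑ v : Fin m → Bool, twist v a * twist v b = if a = b then (2 : ℝ) ^ m else 0 := by
  classical
  have e : ∀ v : Fin m → Bool, twist v a * twist v b = twist v (bxor a b) := fun v =>
    (twist_bxor_right v a b).symm
  simp_rw [e, sum_twist_left]
  exact if_congr (bxor_eq_zeroVec_iff a b) rfl rfl

/-- The PURE bipartite (Maiorana–McFarland-type) function `x ↦ x″ · σ(x′)` of a map `σ : 𝔽₂^m → 𝔽₂^m`. -/
def bipA (σ : (Fin m → Bool) → (Fin m → Bool)) (x : Fin (m + m) → Bool) : Bool := bdot (hi x) (σ (lo x))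

/-- The PURE bipartite function `y ↦ y′ · π(y″)`. -/
def bipB (π : (Fin m → Bool) → (Fin m → Bool)) (y : Fin (m + m) → Bool) : Bool := bdot (lo y) (π (hi y))

/-- Walsh transform of `y′·π(y″)`: `W(x) = 2^m Σ_{v : π v = x′} (-1)^{v·x″}` (for a permutation `π`
this is `± 2^m`: bentness; for a general map the fibre sizes appear). -/
theorem W_bipB (π : (Fin m → Bool) → (Fin m → Bool)) (x : Fin (m + m) → Bool) :
    W (fun y => signOf (bipB π y)) x =
      ∑ v : Fin m → Bool, (if π v = lo x then (2 : ℝ) ^ m else 0) * twist v (hi x) := by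
  classical
  unfold W
  rw [sum_split]
  simp only [bipB, lo_append, hi_append, signOf_bdot]
  rw [sum_comm]
  refine sum_congr rfl fun v _ => ?_
  have e : ∀ u : Fin m → Bool, twist u (π v) * twist (Fin.append u v) x =
      twist v (hi x) * (twist u (π v) * twist u (lo x)) := by
    intro u
    rw [twist_split, lo_append, hi_append]; ring
  rw [sum_congr rfl fun u _ => e u, ← mul_sum, sum_twist_mul_twist, mul_comm]

/-- **Pure bipartite pairs: the closed formula.** For ALL maps `σ, π : 𝔽₂^m → 𝔽₂^m`,
`S(x″·σ(x′), y′·π(y″)) = 4^m · |{z : σ(π z) = z}|`. -/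
theorem fsum_bipartite (σ π : (Fin m → Bool) → (Fin m → Bool)) :
    fsum (fun x => signOf (bipA σ x)) (fun y => signOf (bipB π y)) =
      (2 : ℝ) ^ m * 2 ^ m * ((univ.filter fun z : Fin m → Bool => σ (π z) = z).card : ℝ) := by
  classical
  rw [fsum_eq_sum_mul_W, sum_split]
  simp only [W_bipB, bipA, lo_append, hi_append, signOf_bdot]
  -- Σ_u Σ_v twist v (σ u) * Σ_w [π w = u] 2^m twist w v
  have e1 : ∀ u : Fin m → Bool, ∑ v : Fin m → Bool, twist v (σ u) *
      ∑ w : Fin m → Bool, (if π w = u then (2 : ℝ) ^ m else 0) * twist w v =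
        ∑ w : Fin m → Bool, (if π w = u then (2 : ℝ) ^ m else 0) * (if σ u = w then (2 : ℝ) ^ m else 0) := by
    intro u
    have : ∀ v : Fin m → Bool, twist v (σ u) * ∑ w, (if π w = u then (2 : ℝ) ^ m else 0) * twist w v =
        ∑ w, (if π w = u then (2 : ℝ) ^ m else 0) * (twist v (σ u) * twist v w) := by
      intro v; rw [mul_sum]; refine sum_congr rfl fun w _ => ?_; rw [twist_comm w v]; ring
    rw [sum_congr rfl fun v _ => this v, sum_comm]
    refine sum_congr rfl fun w _ => ?_
    rw [← mul_sum, sum_twist_mul_twist]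
  rw [sum_congr rfl fun u _ => e1 u, sum_comm]
  -- Σ_w Σ_u [π w = u][σ u = w] 4^m = 4^m Σ_w [σ (π w) = w]
  have e2 : ∀ w : Fin m → Bool, ∑ u : Fin m → Bool,
      (if π w = u then (2 : ℝ) ^ m else 0) * (if σ u = w then (2 : ℝ) ^ m else 0) =
        if σ (π w) = w then (2 : ℝ) ^ m * 2 ^ m else 0 := by
    intro w
    rw [Finset.sum_eq_single (π w)]
    · rw [if_pos rfl]; split_ifs <;> ring
    · intro u _ hu; rw [if_neg (Ne.symm hu), zero_mul]
    · intro h; exact absurd (mem_univ _) h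
  rw [sum_congr rfl fun w _ => e2 w, ← Finset.sum_filter, sum_const, nsmul_eq_mul]
  ring

/-- … hence `Φ(x″·σ(x′), y′·π(y″)) = |Fix(σ ∘ π)| / 2^m`. -/
theorem forrelation_bipartite (σ π : (Fin m → Bool) → (Fin m → Bool)) :
    forrelation (bipA σ) (bipB π) =
      ((univ.filter fun z : Fin m → Bool => σ (π z) = z).card : ℝ) / 2 ^ m := by
  rw [← phi_signOf, phi_eq_fsum, fsum_bipartite]
  have h3 : Real.sqrt ((2 : ℝ) ^ (3 * (m + m))) = 2 ^ m * 2 ^ m * 2 ^ m := by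
    rw [show 3 * (m + m) = (3 * m) * 2 by ring, pow_mul, Real.sqrt_sq (by positivity)]; ring
  have h2 : (2 : ℝ) ^ m ≠ 0 := pow_ne_zero _ two_ne_zero
  have h8 : (2 : ℝ) ^ m * 2 ^ m * 2 ^ m ≠ 0 := by positivity
  rw [h3, inv_mul_eq_div, div_eq_div_iff h8 h2]
  ring

/-- **Pure bipartite pairs are never negatively forrelated** — whatever the maps `σ, π`. So within the
pure family (and its complements) IN KNOWN BIPARTITION the signed problem is decided by the parity of
the constant terms; any NO-instance hides its complement in the `h(y″)` part or the affine disguise. -/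
theorem forrelation_bipartite_nonneg (σ π : (Fin m → Bool) → (Fin m → Bool)) :
    0 ≤ forrelation (bipA σ) (bipB π) := by
  rw [forrelation_bipartite]; positivity

/-- The exact pair inside the family: `σ ∘ π = id` (e.g. `σ = π⁻¹` for a permutation) gives `Φ = 1`
(Dillon / Rothaus: `y′·π(y″)` is bent with dual `x″·π⁻¹(x′)`), with NO degree hypothesis. -/
theorem forrelation_bipartite_of_leftInverse {σ π : (Fin m → Bool) → (Fin m → Bool)}
    (h : Function.LeftInverse σ π) : forrelation (bipA σ) (bipB π) = 1 := by
  rw [forrelation_bipartite]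
  have hall : (univ.filter fun z : Fin m → Bool => σ (π z) = z) = univ :=
    filter_true_of_mem fun z _ => h z
  rw [hall, card_univ, Fintype.card_fun, Fintype.card_bool, Fintype.card_fin]
  push_cast
  exact div_self (pow_ne_zero _ two_ne_zero)

/-- A fixed-point-free composite gives `Φ = 0` exactly (e.g. `σ ∘ π` a translation by `s ≠ 0`): the pure
family also contains pairs FAR outside the promise, with the same cubic parts as exact ones
(`σ = π⁻¹ ⊕ s`), so the cubic parts alone never certify the promise. -/
theorem forrelation_bipartite_of_no_fixedPoint {σ π : (Fin m → Bool) → (Fin m → Bool)}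
    (h : ∀ z, σ (π z) ≠ z) : forrelation (bipA σ) (bipB π) = 0 := by
  rw [forrelation_bipartite]
  have hnone : (univ.filter fun z : Fin m → Bool => σ (π z) = z) = ∅ :=
    filter_false_of_mem fun z _ => h z
  rw [hnone, card_empty]; simp

/-- HOMOTOPY LOWER BOUND: along any path of pairs `(σ_t, π_t)` the forrelation is at least the density of
the COMMON fixed points — e.g. if `σ_t ∘ π_t` fixes a set `F` for all `t` then `Φ_t ≥ |F|/2^m`
throughout (the path `(π⁻¹,π) → (id,π) → (id,id)`, one coordinate map at a time, keeps `Fix π`). -/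
theorem forrelation_bipartite_ge_of_fixed (σ π : (Fin m → Bool) → (Fin m → Bool))
    (F : Finset (Fin m → Bool)) (hF : ∀ z ∈ F, σ (π z) = z) :
    (F.card : ℝ) / 2 ^ m ≤ forrelation (bipA σ) (bipB π) := by
  rw [forrelation_bipartite]
  have hsub : F ⊆ univ.filter fun z : Fin m → Bool => σ (π z) = z := fun z hz =>
    mem_filter.2 ⟨mem_univ _, hF z hz⟩
  have : (F.card : ℝ) ≤ (univ.filter fun z : Fin m → Bool => σ (π z) = z).card := by
    exact_mod_cast card_le_card hsub
  exact div_le_div_of_nonneg_right this (by positivity)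

end Bipartite

/-! ### §3c Relative signs are classical: the CROSS derivative-table identity

For real `f, f', g, g'` on `𝔽₂ⁿ` put `X_{f,f'}(h,u) = Σ_x f(x) f'(x ⊕ h) (-1)^{u·x}` (`xdwt`; `X_{f,f} = T_f`
is the tree's `dwt`). Then `Σ_{h,u} X_{f,f'}(h,u) · X_{g',g}(u,h) = S(f,g) · S(f',g')`
(`sum_xdwt_mul_xdwt`, the `f = f'`, `g = g'` case being the landed `sum_dwt_mul_dwt`), with row mass
`Σ_u X_{f,f'}(h,u)² = 4ⁿ` for `±1` data (`sum_xdwt_sq_of_sq`). For `f = (-1)^a`, `f' = (-1)^{a'}` with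
`a, a'` CUBIC and `a ⊕ a'` QUADRATIC, `x ↦ a(x) ⊕ a'(x ⊕ h) = D_h a(x) ⊕ (a ⊕ a')(x ⊕ h)` is quadratic,
so every `X` entry is an exact quadratic Gauss sum and the SAME length-squared sampler as in the `Φ²`
machine estimates the PRODUCT `Φ(a,b) · Φ(a',b')` — the relative sign, with magnitude — across the whole
class `(a + RM(2,n)) × (b + RM(2,n))` with second moment `≤ 1`. Consequence for `X` (prose): the
sign is classical on the promise iff every such class carrying an in-promise pair has ONE anchor pair
`(a',b')` with `|Φ(a',b')| ≥ 1/poly` and classically computable sign; `X` says some class has none. -/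

section Cross

variable {n : ℕ}

/-- The cross derivative table `X_{f,f'}(h,u) = Σ_x f(x) f'(x ⊕ h) (-1)^{u·x}`. -/
def xdwt (f f' : (Fin n → Bool) → ℝ) (h u : Fin n → Bool) : ℝ :=
  ∑ x, f x * f' (bxor x h) * twist u x

/-- `X_{f,f} = T_f`. -/
theorem xdwt_self (f : (Fin n → Bool) → ℝ) : xdwt f f = dwt f := rfl

/-- `Σ_u (-1)^{u·x} X_{g',g}(u,h) = W_g(x) · Σ_y g'(y) (-1)^{y·x} (-1)^{h·y}`. -/
theorem sum_twist_mul_xdwt (g' g : (Fin n → Bool) → ℝ) (x h : Fin n → Bool) :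
    ∑ u, twist u x * xdwt g' g u h = W g x * ∑ y, g' y * twist y x * twist h y := by
  have step : ∀ u : Fin n → Bool,
      twist u x * xdwt g' g u h = ∑ y, g' y * twist h y * (g (bxor y u) * twist u x) := by
    intro u
    unfold xdwt
    rw [mul_sum]
    exact sum_congr rfl fun y _ => by ring
  rw [sum_congr rfl fun u _ => step u, sum_comm, mul_sum]
  refine sum_congr rfl fun y _ => ?_
  rw [← mul_sum, sum_shift_twist g y x]
  ring

/-- Row form: `Σ_u X_{f,f'}(h,u) X_{g',g}(u,h) = Σ_x f(x) f'(x⊕h) W_g(x) Σ_y g'(y) (-1)^{y·x} (-1)^{h·y}`. -/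
theorem sum_xdwt_mul_xdwt_row (f f' g' g : (Fin n → Bool) → ℝ) (h : Fin n → Bool) :
    ∑ u, xdwt f f' h u * xdwt g' g u h =
      ∑ x, f x * f' (bxor x h) * (W g x * ∑ y, g' y * twist y x * twist h y) := by
  have step : ∀ u : Fin n → Bool,
      xdwt f f' h u * xdwt g' g u h = ∑ x, f x * f' (bxor x h) * (twist u x * xdwt g' g u h) := by
    intro u
    rw [xdwt, sum_mul]
    exact sum_congr rfl fun x _ => by ring
  rw [sum_congr rfl fun u _ => step u, sum_comm]
  refine sum_congr rfl fun x _ => ?_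
  rw [← mul_sum, sum_twist_mul_xdwt]

/-- **The cross identity.** For ALL real `f, f', g, g'`:
`Σ_{h,u} X_{f,f'}(h,u) · X_{g',g}(u,h) = S(f,g) · S(f',g')`. -/
theorem sum_xdwt_mul_xdwt (f f' g g' : (Fin n → Bool) → ℝ) :
    ∑ h, ∑ u, xdwt f f' h u * xdwt g' g u h = fsum f g * fsum f' g' := by
  simp_rw [sum_xdwt_mul_xdwt_row]
  rw [sum_comm]
  have hx : ∀ x : Fin n → Bool,
      ∑ h, f x * f' (bxor x h) * (W g x * ∑ y, g' y * twist y x * twist h y) =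
        f x * W g x * ∑ y, g' y * W f' y := by
    intro x
    have e1 : ∀ h : Fin n → Bool, f x * f' (bxor x h) * (W g x * ∑ y, g' y * twist y x * twist h y) =
        ∑ y, f x * W g x * (g' y * twist y x) * (f' (bxor x h) * twist h y) := by
      intro h
      rw [mul_sum, mul_sum]
      exact sum_congr rfl fun y _ => by ring
    rw [sum_congr rfl fun h _ => e1 h, sum_comm, mul_sum]
    refine sum_congr rfl fun y _ => ?_
    rw [← mul_sum, sum_shift_twist f' x y]
    have := Literature.Computability.QuantumComplexity.Simon.twist_mul_self x y
    rw [twist_comm y x]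
    linear_combination (f x * W g x * g' y * W f' y) * this
  rw [sum_congr rfl fun x _ => hx x, ← fsum_eq_sum_mul_W', ← sum_mul, ← fsum_eq_sum_mul_W]

/-- Boolean form: `2^{3n} · Φ(a,b) · Φ(a',b') = Σ_{h,u} X_{a,a'}(h,u) X_{b',b}(u,h)` (data read
through `signOf`). With `a = a'`, `b = b'` this is `two_pow_mul_forrelation_sq`. -/
theorem two_pow_mul_forrelation_mul (a a' b b' : (Fin n → Bool) → Bool) :
    (2 : ℝ) ^ (3 * n) * (forrelation a b * forrelation a' b') =
      ∑ h, ∑ u, xdwt (fun x => signOf (a x)) (fun x => signOf (a' x)) h u *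
        xdwt (fun y => signOf (b' y)) (fun y => signOf (b y)) u h := by
  rw [sum_xdwt_mul_xdwt, ← phi_signOf, ← phi_signOf, phi_eq_fsum, phi_eq_fsum]
  set r := Real.sqrt ((2 : ℝ) ^ (3 * n)) with hr
  set S₁ := fsum (fun x => signOf (a x)) (fun y => signOf (b y))
  set S₂ := fsum (fun x => signOf (a' x)) (fun y => signOf (b' y))
  have hs : r ^ 2 = 2 ^ (3 * n) := Real.sq_sqrt (by positivity)
  have hs0 : r ≠ 0 := Real.sqrt_ne_zero'.2 (by positivity)
  rw [← hs]
  calc r ^ 2 * (r⁻¹ * S₁ * (r⁻¹ * S₂)) = (r * r⁻¹) * (r * r⁻¹) * (S₁ * S₂) := by ring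
    _ = S₁ * S₂ := by rw [mul_inv_cancel₀ hs0]; ring

/-- Row mass of the cross table: `Σ_u X_{f,f'}(h,u)² = 2ⁿ Σ_x (f(x) f'(x⊕h))²`. -/
theorem sum_xdwt_sq (f f' : (Fin n → Bool) → ℝ) (h : Fin n → Bool) :
    ∑ u, xdwt f f' h u ^ 2 = (2 : ℝ) ^ n * ∑ x, (f x * f' (bxor x h)) ^ 2 := by
  set F : (Fin n → Bool) → ℝ := fun x => f x * f' (bxor x h) with hF
  have hd : ∀ u, xdwt f f' h u = ∑ x, F x * twist u x := fun u => rfl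
  have e1 : ∀ u : Fin n → Bool, xdwt f f' h u ^ 2 = ∑ x, ∑ x', F x * F x' * twist u (bxor x x') := by
    intro u
    rw [hd, sq, sum_mul_sum]
    refine sum_congr rfl fun x _ => sum_congr rfl fun x' _ => ?_
    rw [twist_bxor_right]
    ring
  rw [sum_congr rfl fun u _ => e1 u, sum_comm]
  have e2 : ∀ x : Fin n → Bool,
      ∑ u, ∑ x', F x * F x' * twist u (bxor x x') = (2 : ℝ) ^ n * F x ^ 2 := by
    intro x
    rw [sum_comm]
    have e3 : ∀ x' : Fin n → Bool, ∑ u, F x * F x' * twist u (bxor x x') =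
        F x * F x' * (if bxor x x' = zeroVec then (2 : ℝ) ^ n else 0) := by
      intro x'
      rw [← sum_twist_left, mul_sum]
    rw [sum_congr rfl fun x' _ => e3 x']
    simp_rw [bxor_eq_zeroVec_iff, mul_ite, mul_zero]
    rw [Finset.sum_ite_eq univ x, if_pos (mem_univ _)]
    ring
  rw [sum_congr rfl fun x _ => e2 x, ← mul_sum]

/-- … `= 4ⁿ` for `±1`-valued `f, f'`, for EVERY `h`: the cross sampler's law `X²/8ⁿ` is exact. -/
theorem sum_xdwt_sq_of_sq (f f' : (Fin n → Bool) → ℝ) (hf : ∀ x, f x ^ 2 = 1) (hf' : ∀ x, f' x ^ 2 = 1)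
    (h : Fin n → Bool) : ∑ u, xdwt f f' h u ^ 2 = (4 : ℝ) ^ n := by
  rw [sum_xdwt_sq]
  simp_rw [mul_pow, hf, hf', mul_one, sum_const, card_univ, Fintype.card_fun, Fintype.card_bool,
    Fintype.card_fin, nsmul_eq_mul, mul_one]
  push_cast
  rw [← mul_pow]
  norm_num

end Cross

/-! ### §4 Targets (lead's stuck stubs) — none filed -/

/-! ### §5 Near-miss: the crux itself -/

/-- NEAR-MISS (cannot close). `¬X` is crux r7 (`not_crux_iff_r7`): a TOTAL classical randomised
polynomial-time sign decoder for cubic pairs with `|Φ| ≥ 3/5`, plus its `FP` witness. Tried (this seat,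
cycle 1): formal-glitch audit (clean); the unsigned and quadratic weakenings (§2: both false, so any
hardness is carried by SIGN × DEGREE-3 jointly); sub-families where the sign is classical on paper
(§3: KT band reduces to anchors of exact cores; pure bipartite pairs in known coordinates are never
negative; one-sided slice rank / sparsity / block structure `O(log n)`); 2-adic reformulation (on exact
cores the sign is bit `n/2` of `wt(b)`, all lower subcube congruences being handed over by `a` — no
polynomial evaluation of that bit is known: Ax/McEliece expansions need `2^{Ω(n)}` monomial families).
What resists: disguised Maiorana–McFarland cores with generic biquadratic `π` (slice rank `≈ n/2` on
both sides, no sparse orbit representative) — their sign is one BI-ISO seed away (r3 seat), and the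
band `[3/5, θ]` needs r7's structure conjecture. -/
theorem crux_refuted : ¬ SignedCubicForrelationNotPrBPP := by
  sorry

end Summit.QuantumAdvantage.QuantumAdvantage.Cruxes.SignedCubicForrelationNotPrBPP.Disproof

end
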